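import Summits.HodgeConjecture.HodgeConjecture.Theorems.F0P2oU1DichotomyTransport            -- ★ `localCenter_one` lemmas, `LocalLineModelTransport` cone
import Literature.NumberTheory.GelbartRogawski1991.LocalLineIsometryNaturalityHolds           -- ★ S6a hypothesis-free (W-line naturality)
import Literature.RepresentationTheory.MoeglinVignerasWaldspurger1987.RankOneThetaLiftLinesEquivalent  -- ★ `lineTransportOp_equivariant`
import Literature.NumberTheory.GelbartRogawski1991.LocalUnitarySplittingsCMExplicit           -- ★ the undoubled CM member is `localSplittingCM` (`rfl`)
import HarnessLib

/-!
# Crux `H413`, N3 block (lead B-p18 (g29)), row (LM) «LINE MATCHING»: the rank-one Weil representation `ω¹(γ_v, ψ_v) = lineWeilCM`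
# of the CM line package depends on the V-line only through its class modulo local norms

Cell `hodgecm-mathlib` (D-0151), FLOOR 0, crux item H413 = `stmt-HodgeConjecture-24833`; THEOREMS ONLY (kernel lane,
`--supports stmt-HodgeConjecture-24833 --as helper`; no `def`, no instance, no notation, no named fact, no `sorry`).  Seat B-p10 (g22); row (LM)
dealt by the K1∕N3 lead B-p18 (g29) (F0∕P2 bus 2026-08-31T22:06:20Z (3)); consumer = F0P2-p01 (g8)'s (E5)∕(N-iii) assembler of letter N3 (a)
(`GelbartRogawski1991.thetaType_nonsplit_jacquetModule`).  HC_CM is proved only modulo the 2 remaining named inputs (hLiu418, h413) — behind them the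
booked printed statements + the MOD package — until rung 0 closes; nothing here discharges any of them.

WHAT IS PROVED.  For a CM field `L`, two hermitian LINES `(t)`, `(d)` over `L` (`t, d ∈ L` real and non-zero), a conjugate-symplectic `μ`, a
W-line `ε ∈ L⁺ˣ` and a finite place `v` of `L⁺` (split or not) with `t = d · N(y)` in `L ⊗ L⁺_v` for a local unit `y` (`hty`), the two rank-one
Weil representations ★ `lineWeilCM L e₀′ t … μ hμ ε v` and ★ `lineWeilCM L e₀ d … μ hμ ε v` of `U((ε))(L⁺_v) = E¹_v` on `𝒮(L⁺_v)` are
INTERTWINED by a linear automorphism `Tr` (`exists_intertwiner_lineWeilCM_of_eq_mul_norm`): `Tr ∘ ω¹_{(t),ε}(u) = ω¹_{(d),ε}(u) ∘ Tr`.  The N3 consumer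
takes `d := kernelLineCM dV` and `t := ` the anisotropic line of ★ `exists_rational_hyperbolic_frame` (`t = D · N(zc)`).

ROAD (no new rigidity; the V-line change is a W-line change in disguise).  With the RATIONAL ratio `a := t∕d ∈ L⁺ˣ` (both lines are global):
* §1 `omegaCM_localCenter_congr` — the normal form `toRep ∘ localSplittingCM ∘ localCenter` of a CM member read on a fixed presentation `U(J₁)(L⁺_v)`
  of the centre depends on the Gram data `(T₀, J)` only through the MATRICES (`subst`);
* §2 `omegaLoc_lineSplittingsCM_comp_localCenter` — `ω¹_{(dL),a} ∘ localCenter` in that normal form: the `congrW` transport of ★ `UndoublingPlaceAssembly`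
  is a cast (`subst`; pattern of ★ `scaleTransportSection_congrW_s`) and the undoubled member IS ★ `localSplittingCM` (★ `undoubleLoc_finSplittings_s_cmFinLocalFamily`,
  `rfl`); the matrices of the pairs `((t), ε)` and `((d), ε·a)` COINCIDE (`ε·t = (ε a)·d`, §3), so `ω¹_{(t),ε} = ω¹_{(d),εa}` read on `U((ε))`;
* §4 ★ S6a HYPOTHESIS-FREE `lineTransportSplitting_lineTransportSection_congrW_undoubledSplittings_holds` at `N = 1`, `dV := d`, `a₁ := ε·a`, `a₂ := ε`,
  `x := y` (`ε⁻¹δ = y yᶜ (εa)⁻¹δ ⟺ a = y yᶜ`, which is `hty`) + ★ `lineTransportOp_equivariant` give the intertwiner `M_y` between the δ-model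
  readings of `ω¹_{(d),εa}` and `ω¹_{(d),ε}` on `U((d))(L⁺_v)`; ★ `omega_lineTransportSection_comp_localCenter` moves both to `U((ε))(L⁺_v)`.

## References
* [MoeglinVignerasWaldspurger1987] C. Mœglin, M.-F. Vignéras, J.-L. Waldspurger, LNM 1291 (1987): Chap. 2 II.1 (A)–(B); Chap. 3 I.1–I.3.
* [Kudla1994] S. Kudla, Israel J. Math. 87 (1994): §3 Thm. 3.1 (the splitting determined by `χ`).
* [GelbartRogawski1991] S. Gelbart, J. Rogawski, Invent. Math. 105 (1991): §3.1 Prop. 3.1.1 p. 455, Remark p. 457; §5.2 p. 467 L8–11.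
* [HarrisKudlaSweet1996] M. Harris, S. Kudla, W. Sweet, JAMS 9 (1996): §1 (1.11)–(1.16).
-/

set_option autoImplicit false
-- the mandated namespace has the single-problem summit's repeated segment (`HodgeConjecture.HodgeConjecture`)
set_option linter.dupNamespace false

noncomputable section

open NumberField IsDedekindDomain MeasureTheory
open scoped Matrix Kronecker

open Literature.NumberTheory Literature.NumberTheory.Automorphic Literature.NumberTheory.Automorphic.UnitaryGroup
open Literature.NumberTheory.Automorphic.IdeleClassGroup
open Literature.NumberTheory.Automorphic.Liu2021 Literature.NumberTheory.Automorphic.Liu2021.Def411WeilCarriers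
open Literature.NumberTheory.Automorphic.Liu2021.Def411WeilCarriersDoubling (lineW complexConj_lineW lineW_ne_zero realDiagonal_lineW diagonal_lineW)
open Literature.NumberTheory.Rogawski1990 Literature.NumberTheory.GaloisRepresentations
open Literature.RepresentationTheory.HarrisKudlaSweet1996 (IsSplittingChar)
open Literature.NumberTheory.GelbartRogawski1991 Literature.NumberTheory.GelbartRogawski1991.UnitaryDualPair
open Literature.NumberTheory.GelbartRogawski1991.UnitaryDualPair.LocalSplitting
open Literature.NumberTheory.GelbartRogawski1991.GRConstruction (Fp gramR gramR_isSymm isUnit_det_gramR₀ congrW undoubledSplittings cmFinLocalFamily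
  borelPlaceMeasure)
open Literature.RepresentationTheory Literature.RepresentationTheory.HeisenbergGroup
open Literature.RepresentationTheory.MoeglinVignerasWaldspurger1987
open Literature.RepresentationTheory.Liu2021 (isOscillatorChar_toHeckeCharacter_iff)

namespace Summit.HodgeConjecture.HodgeConjecture.Cruxes.H413.F0P2oLineWeilCMLineMatching

open Summit.HodgeConjecture.HodgeConjecture.Cruxes.H413.F0P2oU1DichotomyTransport

variable (L : Type) [Field L] [NumberField L] [IsCMField L]

/-! ## §1 The normal form of a CM member on a fixed presentation of the centre depends on the Gram data only through the matrices -/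

set_option maxHeartbeats 1600000 in
/-- **congruence of the normal form** `toRep ∘ localSplittingCM(T₀, J) ∘ localCenter(J, J₁)` along equal Gram data `T₀ = T₀′`, `J = J′`
(the proof-carrying arguments are irrelevant; `subst`). [cite: GelbartRogawski1991, §3.1 Prop. 3.1.1 p. 455 L1–3] -/
theorem omegaCM_localCenter_congr {n : ℕ} {T₀ T₀' : Matrix (Fin n) (Fin n) (Fp L)} (hT₀ : T₀.IsSymm) (hT₀d : IsUnit T₀.det)
    (hT₀' : T₀'.IsSymm) (hT₀d' : IsUnit T₀'.det) {J J' : Matrix (Fin n) (Fin n) L} (hJ : J = T₀.map (algebraMap (Fp L) L))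
    (hJ' : J' = T₀'.map (algebraMap (Fp L) L)) (χ : HeckeCharacter L) (hχ : IsSplittingChar L 1 χ)
    (v : HeightOneSpectrum (𝓞 (Fp L))) (J₁ : Matrix (Fin 1) (Fin 1) L) (hJ₁ : J₁ 0 0 ≠ 0) (hTT : T₀ = T₀') (hJJ : J = J') :
    (show Representation ℂ ↥(localPi L (IsCMField.complexConj L) 1 J₁ v) (SchwartzBruhat (Fin n → v.adicCompletion (Fp L))) from
      ((MpPsi.toRep (localSchrodinger (Fp L) n T₀ v)).comp (localSplittingCM L n hT₀ hT₀d hJ χ hχ v)).comp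
        (localCenter L (IsCMField.complexConj L) n J J₁ hJ₁ v)) =
    (show Representation ℂ ↥(localPi L (IsCMField.complexConj L) 1 J₁ v) (SchwartzBruhat (Fin n → v.adicCompletion (Fp L))) from
      ((MpPsi.toRep (localSchrodinger (Fp L) n T₀' v)).comp (localSplittingCM L n hT₀' hT₀d' hJ' χ hχ v)).comp
        (localCenter L (IsCMField.complexConj L) n J' J₁ hJ₁ v)) := by
  subst hTT hJJ
  rfl

/-! ## §2 `ω¹ ∘ localCenter` in normal form -/

set_option synthInstance.maxHeartbeats 400000 in
set_option maxHeartbeats 8000000 in -- MEASURED (as ★ S6a): the CM line package spelled in full exceeds the default budget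
/-- **`ω¹_{(dL),a}` read on any presentation `U(J₁)(L⁺_v)` of the centre, in normal form**: the `congrW` transport of ★ `UndoublingPlaceAssembly` is a
cast and the undoubled member of ★ `cmFinLocalFamily` IS ★ `localSplittingCM` of the Gram matrix `gramR e₀ (dL) (lineW (a))` (`rfl` after `subst`,
★ `undoubleLoc_finSplittings_s_cmFinLocalFamily`). [cite: GelbartRogawski1991, §3.1 Prop. 3.1.1 p. 455 L1–3; §5.2 p. 467 L8–11] -/
theorem omegaLoc_congrW_comp_localCenter (dL : Fin 1 → L) (hdL : ∀ i, IsCMField.complexConj L (dL i) = dL i) (hdL0 : ∀ i, dL i ≠ 0)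
    (χ : HeckeCharacter L) (hχ : IsSplittingChar L 1 χ) (a : (Fp L)ˣ) {TW' : Matrix (Fin 1) (Fin 1) (Fp L)} {JW' : Matrix (Fin 1) (Fin 1) L}
    (hT : realDiagonal L (lineW L (TW (Fp L) a)) (complexConj_lineW L (TW (Fp L) a)) = TW')
    (hJ : Matrix.diagonal (lineW L (TW (Fp L) a)) = JW') (hW' : TW'.IsSymm) (hJW' : JW' = TW'.map (algebraMap (Fp L) L))
    (v : HeightOneSpectrum (𝓞 (Fp L))) (J₁ : Matrix (Fin 1) (Fin 1) L) (hJ₁ : J₁ 0 0 ≠ 0) :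
    (show Representation ℂ ↥(localPi L (IsCMField.complexConj L) 1 J₁ v) (SchwartzBruhat (Fin 1 → v.adicCompletion (Fp L))) from
      ((congrW L (Equiv.prodUnique (Fin 1) (Fin 1)) dL hdL (lineW L (TW (Fp L) a)) (complexConj_lineW L (TW (Fp L) a)) hT hJ
          (undoubledSplittings L (Equiv.prodUnique (Fin 1) (Fin 1)) dL hdL hdL0 (lineW L (TW (Fp L) a)) (complexConj_lineW L (TW (Fp L) a))
            (lineW_ne_zero L (TW (Fp L) a) (isUnit_det_TW (Fp L) a)) χ (borelPlaceMeasure L)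
            (cmFinLocalFamily L (Equiv.prodUnique (Fin 1) (Fin 1)) dL hdL hdL0 (lineW L (TW (Fp L) a)) (complexConj_lineW L (TW (Fp L) a))
              (lineW_ne_zero L (TW (Fp L) a) (isUnit_det_TW (Fp L) a)) χ hχ (borelPlaceMeasure L))) hW' hJW').omegaLoc v).comp
        (localCenter L (IsCMField.complexConj L) 1
          (Matrix.reindex (Equiv.prodUnique (Fin 1) (Fin 1)) (Equiv.prodUnique (Fin 1) (Fin 1)) (Matrix.diagonal dL ⊗ₖ JW')) J₁ hJ₁ v)) =
    (show Representation ℂ ↥(localPi L (IsCMField.complexConj L) 1 J₁ v) (SchwartzBruhat (Fin 1 → v.adicCompletion (Fp L))) from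
      ((MpPsi.toRep (localSchrodinger (Fp L) 1 (gramR L (Equiv.prodUnique (Fin 1) (Fin 1)) dL hdL (lineW L (TW (Fp L) a))
          (complexConj_lineW L (TW (Fp L) a))) v)).comp
        (localSplittingCM L 1 (gramR_isSymm L (Equiv.prodUnique (Fin 1) (Fin 1)) dL hdL (lineW L (TW (Fp L) a)) (complexConj_lineW L (TW (Fp L) a)))
          (isUnit_det_gramR₀ L (Equiv.prodUnique (Fin 1) (Fin 1)) dL hdL hdL0 (lineW L (TW (Fp L) a)) (complexConj_lineW L (TW (Fp L) a))
            (lineW_ne_zero L (TW (Fp L) a) (isUnit_det_TW (Fp L) a)))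
          (reindex_kronecker_eq_gram_map (Fp L) L (Equiv.prodUnique (Fin 1) (Fin 1)) (realDiagonal_map L dL hdL).symm
            (realDiagonal_map L (lineW L (TW (Fp L) a)) (complexConj_lineW L (TW (Fp L) a))).symm) χ hχ v)).comp
        (localCenter L (IsCMField.complexConj L) 1
          (Matrix.reindex (Equiv.prodUnique (Fin 1) (Fin 1)) (Equiv.prodUnique (Fin 1) (Fin 1))
            (Matrix.diagonal dL ⊗ₖ Matrix.diagonal (lineW L (TW (Fp L) a)))) J₁ hJ₁ v)) := by
  subst hT hJ
  rfl

/-! ## §3 The bookkeeping of the two pairs `((t), ε)` and `((d), ε·a)`, `a = t∕d` -/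

/-- the real line entry `⟨dL 0⟩ ∈ L⁺` of a real line is non-zero. [folklore] -/
theorem realEntry_ne_zero (dL : Fin 1 → L) (hdL : ∀ i, IsCMField.complexConj L (dL i) = dL i) (hdL0 : ∀ i, dL i ≠ 0) :
    (⟨dL 0, (IsCMField.complexConj_eq_self_iff (K := L) (dL 0)).1 (hdL 0)⟩ : Fp L) ≠ 0 := fun h =>
  hdL0 0 (by simpa using congrArg (fun x : Fp L => (x : L)) h)

omit [NumberField L] [IsCMField L] in
/-- `lineW (TW a) 0 = a`. [folklore] -/
theorem lineW_TW_apply (a : (Fp L)ˣ) (i : Fin 1) : lineW L (TW (Fp L) a) i = ((a : Fp L) : L) := by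
  obtain rfl : i = 0 := Subsingleton.elim _ _
  rfl

/-- **the rational Gram matrices of `((t), ε)` and `((d), ε·a)` coincide** when `⟨t 0⟩ = a · ⟨d 0⟩` in `L⁺` (`ε·t = (εa)·d`).
[cite: GelbartRogawski1991, §3.1 Prop. 3.1.1 p. 455 L1–2] -/
theorem gramR_line_eq (t d : Fin 1 → L) (ht : ∀ i, IsCMField.complexConj L (t i) = t i) (hd : ∀ i, IsCMField.complexConj L (d i) = d i)
    (ε a : (Fp L)ˣ)
    (hta : (⟨t 0, (IsCMField.complexConj_eq_self_iff (K := L) (t 0)).1 (ht 0)⟩ : Fp L) =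
      (a : Fp L) * ⟨d 0, (IsCMField.complexConj_eq_self_iff (K := L) (d 0)).1 (hd 0)⟩) :
    gramR L (Equiv.prodUnique (Fin 1) (Fin 1)) t ht (lineW L (TW (Fp L) ε)) (complexConj_lineW L (TW (Fp L) ε)) =
      gramR L (Equiv.prodUnique (Fin 1) (Fin 1)) d hd (lineW L (TW (Fp L) (ε * a))) (complexConj_lineW L (TW (Fp L) (ε * a))) := by
  change gram (Fp L) (Equiv.prodUnique (Fin 1) (Fin 1)) (realDiagonal L t ht)
      (realDiagonal L (lineW L (TW (Fp L) ε)) (complexConj_lineW L (TW (Fp L) ε))) =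
    gram (Fp L) (Equiv.prodUnique (Fin 1) (Fin 1)) (realDiagonal L d hd)
      (realDiagonal L (lineW L (TW (Fp L) (ε * a))) (complexConj_lineW L (TW (Fp L) (ε * a))))
  rw [realDiagonal_lineW, realDiagonal_lineW, gram_prodUnique_TW, gram_prodUnique_TW]
  ext i j
  obtain rfl : i = 0 := Subsingleton.elim _ _
  obtain rfl : j = 0 := Subsingleton.elim _ _
  rw [Matrix.smul_apply, Matrix.smul_apply, realDiagonal, realDiagonal, Matrix.diagonal_apply_eq, Matrix.diagonal_apply_eq, smul_eq_mul,
    smul_eq_mul, hta, Units.val_mul, mul_assoc]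

omit [NumberField L] [IsCMField L] in
/-- **the hermitian Gram matrices of `((t), ε)` and `((d), ε·a)` coincide** when `t 0 = a · d 0` in `L`.
[cite: GelbartRogawski1991, §3.1 Prop. 3.1.1 p. 455 L1–2] -/
theorem reindex_kronecker_line_eq (t d : Fin 1 → L) (ε a : (Fp L)ˣ) (hta : t 0 = ((a : Fp L) : L) * d 0) :
    Matrix.reindex (Equiv.prodUnique (Fin 1) (Fin 1)) (Equiv.prodUnique (Fin 1) (Fin 1))
        (Matrix.diagonal t ⊗ₖ Matrix.diagonal (lineW L (TW (Fp L) ε))) =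
      Matrix.reindex (Equiv.prodUnique (Fin 1) (Fin 1)) (Equiv.prodUnique (Fin 1) (Fin 1))
        (Matrix.diagonal d ⊗ₖ Matrix.diagonal (lineW L (TW (Fp L) (ε * a)))) := by
  ext i j
  obtain rfl : i = 0 := Subsingleton.elim _ _
  obtain rfl : j = 0 := Subsingleton.elim _ _
  simp only [Matrix.reindex_apply, Matrix.submatrix_apply, Matrix.kroneckerMap_apply, Equiv.prodUnique_symm_apply]
  change Matrix.diagonal t 0 0 * Matrix.diagonal (lineW L (TW (Fp L) ε)) default default =
    Matrix.diagonal d 0 0 * Matrix.diagonal (lineW L (TW (Fp L) (ε * a))) default default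
  rw [Matrix.diagonal_apply_eq, Matrix.diagonal_apply_eq, Matrix.diagonal_apply_eq, Matrix.diagonal_apply_eq, lineW_TW_apply,
    lineW_TW_apply, Units.val_mul, Subfield.coe_mul, hta]
  ring

/-! ## §4 The head: `ω¹_{(t),ε} ≅ ω¹_{(d),ε}` for `t = d · N(y)` -/

set_option synthInstance.maxHeartbeats 400000 in
set_option maxHeartbeats 16000000 in -- MEASURED (as ★ S6a and ★ `ThetaDichotomyVocabulary`): two CM line packages spelled in full
/-- **(LM) LINE MATCHING — `ω¹(γ_v, ψ_v)` DEPENDS ON THE V-LINE ONLY THROUGH ITS CLASS MODULO LOCAL NORMS.**  For a CM field `L`, real non-zero lines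
`t, d : Fin 1 → L`, a conjugate-symplectic `μ`, a W-line `ε ∈ L⁺ˣ`, a finite place `v` of `L⁺` and a local unit `y ∈ (L ⊗ L⁺_v)ˣ` with
`t = d · y yᶜ` in `L ⊗ L⁺_v` (`hty`), there is a linear automorphism `Tr` of `𝒮(L⁺_v)` with `Tr (ω¹_{(t),ε}(u) f) = ω¹_{(d),ε}(u) (Tr f)` for all
`u ∈ U((ε))(L⁺_v)`, `ω¹_{(dL),ε} := lineWeilCM L e₀ dL … μ hμ ε v` (★ `ThetaDichotomyVocabulary`).  `Tr = M_y`, the operator of a lift of the line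
isometry `y` ([MVW, Chap. 2 II.1 (B)]); route: `((t), ε)` and `((d), ε·(t∕d))` have the same Gram matrices (§3, §1–§2), and `((d), ε·(t∕d)) ~ ((d), ε)`
is ★ S6a (Kudla's splitting is natural under the isometry of two W-lines of the same class).
[cite: MoeglinVignerasWaldspurger1987, Chap. 2 II.1 (A)–(B); Chap. 3 I.1–I.3] [cite: Kudla1994, §3 Thm 3.1] [cite: GelbartRogawski1991, §3.1 Remark p. 457; §5.2 p. 467 L8–11] -/
theorem exists_intertwiner_lineWeilCM_of_eq_mul_norm {n₀ n₀' : ℕ} (e₀ : Fin 1 × Fin 1 ≃ Fin n₀) (e₀' : Fin 1 × Fin 1 ≃ Fin n₀')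
    (d t : Fin 1 → L) (hd : ∀ i, IsCMField.complexConj L (d i) = d i) (hd0 : ∀ i, d i ≠ 0)
    (ht : ∀ i, IsCMField.complexConj L (t i) = t i) (ht0 : ∀ i, t i ≠ 0)
    (μ : Literature.NumberTheory.Automorphic.IdeleClassGroup L →ₜ* Circle) (hμ : IsConjugateSymplectic L μ)
    (ε : (Fp L)ˣ) (v : HeightOneSpectrum (𝓞 (Fp L))) (y : (UnitaryGroup.LocalRing L v)ˣ)
    (hty : algebraMap L (UnitaryGroup.LocalRing L v) (t 0) =
      algebraMap L (UnitaryGroup.LocalRing L v) (d 0) * ((y : UnitaryGroup.LocalRing L v) * conjLocal L (IsCMField.complexConj L) v y)) :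
    ∃ Tr : SchwartzBruhat (Fin n₀' → v.adicCompletion (Fp L)) ≃ₗ[ℂ] SchwartzBruhat (Fin n₀ → v.adicCompletion (Fp L)),
      ∀ (u : ↥(localPi L (IsCMField.complexConj L) 1 (JW (Fp L) L ε) v)) (f : SchwartzBruhat (Fin n₀' → v.adicCompletion (Fp L))),
        Tr (lineWeilCM L e₀' t ht ht0 μ hμ ε v u f) = lineWeilCM L e₀ d hd hd0 μ hμ ε v u (Tr f) := by
  -- (a) the only reindexings: `n₀ = n₀' = 1`, `e₀ = e₀' = Equiv.prodUnique`
  obtain rfl : n₀ = 1 := by simpa using (Fintype.card_congr e₀).symm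
  obtain rfl : e₀ = Equiv.prodUnique (Fin 1) (Fin 1) := Equiv.ext fun _ => Subsingleton.elim _ _
  obtain rfl : n₀' = 1 := by simpa using (Fintype.card_congr e₀').symm
  obtain rfl : e₀' = Equiv.prodUnique (Fin 1) (Fin 1) := Equiv.ext fun _ => Subsingleton.elim _ _
  -- (b) the rational ratio `a = t∕d ∈ L⁺ˣ`
  have htR0 := realEntry_ne_zero L t ht ht0
  have hdR0 := realEntry_ne_zero L d hd hd0
  obtain ⟨a, ha⟩ : ∃ a : (Fp L)ˣ, (⟨t 0, (IsCMField.complexConj_eq_self_iff (K := L) (t 0)).1 (ht 0)⟩ : Fp L) =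
      (a : Fp L) * ⟨d 0, (IsCMField.complexConj_eq_self_iff (K := L) (d 0)).1 (hd 0)⟩ :=
    ⟨Units.mk0 _ htR0 * (Units.mk0 _ hdR0)⁻¹, by
      rw [Units.val_mul, Units.val_inv_eq_inv_val, Units.val_mk0, Units.val_mk0, inv_mul_cancel_right₀ hdR0]⟩
  have haL : t 0 = ((a : Fp L) : L) * d 0 := by simpa using congrArg (fun x : Fp L => (x : L)) ha
  have hdU : IsUnit (algebraMap L (UnitaryGroup.LocalRing L v) (d 0)) := (isUnit_iff_ne_zero.2 (hd0 0)).map _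
  -- (c) the S6a hypothesis `ε⁻¹δ = y yᶜ (εa)⁻¹δ`, from `hty` and `a = t∕d`
  have hya : (y : UnitaryGroup.LocalRing L v) * conjLocal L (IsCMField.complexConj L) v y =
      algebraMap L (UnitaryGroup.LocalRing L v) (((a : Fp L) : L)) := by
    have h1 : algebraMap L (UnitaryGroup.LocalRing L v) (d 0) * ((y : UnitaryGroup.LocalRing L v) * conjLocal L (IsCMField.complexConj L) v y) =
        algebraMap L (UnitaryGroup.LocalRing L v) (d 0) * algebraMap L (UnitaryGroup.LocalRing L v) (((a : Fp L) : L)) := by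
      rw [← hty, haL, map_mul, mul_comm (algebraMap L (UnitaryGroup.LocalRing L v) (((a : Fp L) : L)))]
    exact hdU.mul_left_cancel h1
  have hx : algebraMap L (UnitaryGroup.LocalRing L v) (algebraMap (Fp L) L (↑ε⁻¹ : Fp L) * imagUnit L) =
      (y : UnitaryGroup.LocalRing L v) * conjLocal L (IsCMField.complexConj L) v y *
        algebraMap L (UnitaryGroup.LocalRing L v) (algebraMap (Fp L) L (↑(ε * a)⁻¹ : Fp L) * imagUnit L) := by
    rw [hya, ← map_mul, ← mul_assoc]
    congr 2
    change algebraMap (Fp L) L (↑ε⁻¹ : Fp L) = algebraMap (Fp L) L (a : Fp L) * algebraMap (Fp L) L (↑(ε * a)⁻¹ : Fp L)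
    rw [← map_mul, mul_inv_rev, Units.val_mul, Units.mul_inv_cancel_left]
  -- (d) the δ-model readings: the transported sections `S_{d,a′} = lineTransportSection_{a′} (𝓢_{d,a′}.s v)` on `U((d))(L⁺_v)`
  have hJε : JW (Fp L) L ε 0 0 ≠ 0 := JW_apply_ne_zero (Fp L) L ε
  -- the W-line naturality S6a at `dV := d`, `a₁ := ε·a`, `a₂ := ε` (stated in the `lineSplittingsCM` spelling)
  have S6 : lineTransportSplitting L v (IsCMField.complexConj L) 1 (conj_lineDelta (complexConj_imagUnit L) (ε * a))
      (lineDelta_ne_zero (imagUnit_ne_zero L) (ε * a)) (lineDelta_mul_self (imagUnit_mul_self L) (ε * a))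
      (conj_lineDelta (complexConj_imagUnit L) ε) (lineDelta_ne_zero (imagUnit_ne_zero L) ε) (lineDelta_mul_self (imagUnit_mul_self L) ε) y
      (realDiagonal L d hd) (realDiagonal_isSymm L d hd) (isUnit_det_realDiagonal L d hd hd0) hx
      (lineTransportSection (Fp L) L (IsCMField.complexConj L) 1 (complexConj_imagUnit L) (imagUnit_ne_zero L) (imagUnit_mul_self L)
        (realDiagonal L d hd) (realDiagonal_isSymm L d hd) (Matrix.diagonal d) (realDiagonal_map L d hd).symm (ε * a) v
        ((lineSplittingsCM L (Equiv.prodUnique (Fin 1) (Fin 1)) d hd hd0 (toHeckeCharacter L μ)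
          ((isOscillatorChar_toHeckeCharacter_iff μ).mpr hμ) (ε * a)).s v)
        ((lineSplittingsCM L (Equiv.prodUnique (Fin 1) (Fin 1)) d hd hd0 (toHeckeCharacter L μ)
          ((isOscillatorChar_toHeckeCharacter_iff μ).mpr hμ) (ε * a)).proj_s v)) =
      lineTransportSection (Fp L) L (IsCMField.complexConj L) 1 (complexConj_imagUnit L) (imagUnit_ne_zero L) (imagUnit_mul_self L)
        (realDiagonal L d hd) (realDiagonal_isSymm L d hd) (Matrix.diagonal d) (realDiagonal_map L d hd).symm ε v
        ((lineSplittingsCM L (Equiv.prodUnique (Fin 1) (Fin 1)) d hd hd0 (toHeckeCharacter L μ)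
          ((isOscillatorChar_toHeckeCharacter_iff μ).mpr hμ) ε).s v)
        ((lineSplittingsCM L (Equiv.prodUnique (Fin 1) (Fin 1)) d hd hd0 (toHeckeCharacter L μ)
          ((isOscillatorChar_toHeckeCharacter_iff μ).mpr hμ) ε).proj_s v) :=
    lineTransportSplitting_lineTransportSection_congrW_undoubledSplittings_holds L d hd hd0 v Nat.one_pos
      (toHeckeCharacter L μ) ((isOscillatorChar_toHeckeCharacter_iff μ).mpr hμ) (ε * a) ε y hx
  -- the intertwiner `M_y`
  refine ⟨lineTransportOp L v (IsCMField.complexConj L) 1 (conj_lineDelta (complexConj_imagUnit L) (ε * a))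
    (lineDelta_ne_zero (imagUnit_ne_zero L) (ε * a)) (lineDelta_mul_self (imagUnit_mul_self L) (ε * a))
    (conj_lineDelta (complexConj_imagUnit L) ε) (lineDelta_ne_zero (imagUnit_ne_zero L) ε) (lineDelta_mul_self (imagUnit_mul_self L) ε) y
    (realDiagonal L d hd) (realDiagonal_isSymm L d hd) (isUnit_det_realDiagonal L d hd hd0) hx, fun u f => ?_⟩
  -- (e) `ω¹_{(t),ε} ∘ localCenter = ω¹_{(d),εa} ∘ localCenter` on `U((ε))` (normal forms + equal matrices)
  have E1 := omegaLoc_congrW_comp_localCenter L t ht ht0 (toHeckeCharacter L μ) ((isOscillatorChar_toHeckeCharacter_iff μ).mpr hμ) ε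
    (realDiagonal_lineW L (TW (Fp L) ε)) (diagonal_lineW L (TW (Fp L) ε) (JW_eq (Fp L) L ε)) (isSymm_TW (Fp L) ε) (JW_eq (Fp L) L ε) v
    (JW (Fp L) L ε) hJε
  have E2 := omegaCM_localCenter_congr L
    (gramR_isSymm L (Equiv.prodUnique (Fin 1) (Fin 1)) t ht (lineW L (TW (Fp L) ε)) (complexConj_lineW L (TW (Fp L) ε)))
    (isUnit_det_gramR₀ L (Equiv.prodUnique (Fin 1) (Fin 1)) t ht ht0 (lineW L (TW (Fp L) ε)) (complexConj_lineW L (TW (Fp L) ε))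
      (lineW_ne_zero L (TW (Fp L) ε) (isUnit_det_TW (Fp L) ε)))
    (gramR_isSymm L (Equiv.prodUnique (Fin 1) (Fin 1)) d hd (lineW L (TW (Fp L) (ε * a))) (complexConj_lineW L (TW (Fp L) (ε * a))))
    (isUnit_det_gramR₀ L (Equiv.prodUnique (Fin 1) (Fin 1)) d hd hd0 (lineW L (TW (Fp L) (ε * a))) (complexConj_lineW L (TW (Fp L) (ε * a)))
      (lineW_ne_zero L (TW (Fp L) (ε * a)) (isUnit_det_TW (Fp L) (ε * a))))
    (reindex_kronecker_eq_gram_map (Fp L) L (Equiv.prodUnique (Fin 1) (Fin 1)) (realDiagonal_map L t ht).symm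
      (realDiagonal_map L (lineW L (TW (Fp L) ε)) (complexConj_lineW L (TW (Fp L) ε))).symm)
    (reindex_kronecker_eq_gram_map (Fp L) L (Equiv.prodUnique (Fin 1) (Fin 1)) (realDiagonal_map L d hd).symm
      (realDiagonal_map L (lineW L (TW (Fp L) (ε * a))) (complexConj_lineW L (TW (Fp L) (ε * a)))).symm)
    (toHeckeCharacter L μ) ((isOscillatorChar_toHeckeCharacter_iff μ).mpr hμ) v (JW (Fp L) L ε) hJε
    (gramR_line_eq L t d ht hd ε a ha) (reindex_kronecker_line_eq L t d ε a haL)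
  have E3 := omegaLoc_congrW_comp_localCenter L d hd hd0 (toHeckeCharacter L μ) ((isOscillatorChar_toHeckeCharacter_iff μ).mpr hμ) (ε * a)
    (realDiagonal_lineW L (TW (Fp L) (ε * a))) (diagonal_lineW L (TW (Fp L) (ε * a)) (JW_eq (Fp L) L (ε * a))) (isSymm_TW (Fp L) (ε * a))
    (JW_eq (Fp L) L (ε * a)) v (JW (Fp L) L ε) hJε
  -- (f) the δ-model readings through `localCenter` into `U((d))`
  have E4 := omega_lineTransportSection_comp_localCenter (Fp L) L (IsCMField.complexConj L) 1 (complexConj_imagUnit L) (imagUnit_ne_zero L)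
    (imagUnit_mul_self L) (realDiagonal L d hd) (realDiagonal_isSymm L d hd) (Matrix.diagonal d) (realDiagonal_map L d hd).symm (ε * a) v
    ((lineSplittingsCM L (Equiv.prodUnique (Fin 1) (Fin 1)) d hd hd0 (toHeckeCharacter L μ) ((isOscillatorChar_toHeckeCharacter_iff μ).mpr hμ)
      (ε * a)).s v)
    ((lineSplittingsCM L (Equiv.prodUnique (Fin 1) (Fin 1)) d hd hd0 (toHeckeCharacter L μ) ((isOscillatorChar_toHeckeCharacter_iff μ).mpr hμ)
      (ε * a)).proj_s v) (JW (Fp L) L ε) hJε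
  have E5 := omega_lineTransportSection_comp_localCenter (Fp L) L (IsCMField.complexConj L) 1 (complexConj_imagUnit L) (imagUnit_ne_zero L)
    (imagUnit_mul_self L) (realDiagonal L d hd) (realDiagonal_isSymm L d hd) (Matrix.diagonal d) (realDiagonal_map L d hd).symm ε v
    ((lineSplittingsCM L (Equiv.prodUnique (Fin 1) (Fin 1)) d hd hd0 (toHeckeCharacter L μ) ((isOscillatorChar_toHeckeCharacter_iff μ).mpr hμ)
      ε).s v)
    ((lineSplittingsCM L (Equiv.prodUnique (Fin 1) (Fin 1)) d hd hd0 (toHeckeCharacter L μ) ((isOscillatorChar_toHeckeCharacter_iff μ).mpr hμ)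
      ε).proj_s v) (JW (Fp L) L ε) hJε
  -- (g) assemble at `(u, f)`
  have hL : lineWeilCM L (Equiv.prodUnique (Fin 1) (Fin 1)) t ht ht0 μ hμ ε v u =
      ((MpPsi.toRep (localSchrodinger (Fp L) 1 (realDiagonal L d hd) v)).comp
        (lineTransportSection (Fp L) L (IsCMField.complexConj L) 1 (complexConj_imagUnit L) (imagUnit_ne_zero L) (imagUnit_mul_self L)
          (realDiagonal L d hd) (realDiagonal_isSymm L d hd) (Matrix.diagonal d) (realDiagonal_map L d hd).symm (ε * a) v
          ((lineSplittingsCM L (Equiv.prodUnique (Fin 1) (Fin 1)) d hd hd0 (toHeckeCharacter L μ)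
            ((isOscillatorChar_toHeckeCharacter_iff μ).mpr hμ) (ε * a)).s v)
          ((lineSplittingsCM L (Equiv.prodUnique (Fin 1) (Fin 1)) d hd hd0 (toHeckeCharacter L μ)
            ((isOscillatorChar_toHeckeCharacter_iff μ).mpr hμ) (ε * a)).proj_s v)))
        (localCenter L (IsCMField.complexConj L) 1 (Matrix.diagonal d) (JW (Fp L) L ε) hJε v u) := by
    have h := ((E1.trans E2).trans E3.symm).trans E4.symm
    exact DFunLike.congr_fun h u
  have hR : lineWeilCM L (Equiv.prodUnique (Fin 1) (Fin 1)) d hd hd0 μ hμ ε v u =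
      ((MpPsi.toRep (localSchrodinger (Fp L) 1 (realDiagonal L d hd) v)).comp
        (lineTransportSection (Fp L) L (IsCMField.complexConj L) 1 (complexConj_imagUnit L) (imagUnit_ne_zero L) (imagUnit_mul_self L)
          (realDiagonal L d hd) (realDiagonal_isSymm L d hd) (Matrix.diagonal d) (realDiagonal_map L d hd).symm ε v
          ((lineSplittingsCM L (Equiv.prodUnique (Fin 1) (Fin 1)) d hd hd0 (toHeckeCharacter L μ)
            ((isOscillatorChar_toHeckeCharacter_iff μ).mpr hμ) ε).s v)
          ((lineSplittingsCM L (Equiv.prodUnique (Fin 1) (Fin 1)) d hd hd0 (toHeckeCharacter L μ)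
            ((isOscillatorChar_toHeckeCharacter_iff μ).mpr hμ) ε).proj_s v)))
        (localCenter L (IsCMField.complexConj L) 1 (Matrix.diagonal d) (JW (Fp L) L ε) hJε v u) :=
    DFunLike.congr_fun E5.symm u
  rw [hL, hR]
  have hq := lineTransportOp_equivariant L v (IsCMField.complexConj L) 1 (conj_lineDelta (complexConj_imagUnit L) (ε * a))
    (lineDelta_ne_zero (imagUnit_ne_zero L) (ε * a)) (lineDelta_mul_self (imagUnit_mul_self L) (ε * a))
    (conj_lineDelta (complexConj_imagUnit L) ε) (lineDelta_ne_zero (imagUnit_ne_zero L) ε) (lineDelta_mul_self (imagUnit_mul_self L) ε) y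
    (realDiagonal L d hd) (realDiagonal_isSymm L d hd) (isUnit_det_realDiagonal L d hd hd0) hx
    (lineTransportSection (Fp L) L (IsCMField.complexConj L) 1 (complexConj_imagUnit L) (imagUnit_ne_zero L) (imagUnit_mul_self L)
      (realDiagonal L d hd) (realDiagonal_isSymm L d hd) (Matrix.diagonal d) (realDiagonal_map L d hd).symm (ε * a) v
      ((lineSplittingsCM L (Equiv.prodUnique (Fin 1) (Fin 1)) d hd hd0 (toHeckeCharacter L μ)
        ((isOscillatorChar_toHeckeCharacter_iff μ).mpr hμ) (ε * a)).s v)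
      ((lineSplittingsCM L (Equiv.prodUnique (Fin 1) (Fin 1)) d hd hd0 (toHeckeCharacter L μ)
        ((isOscillatorChar_toHeckeCharacter_iff μ).mpr hμ) (ε * a)).proj_s v))
    (localCenter L (IsCMField.complexConj L) 1 (Matrix.diagonal d) (JW (Fp L) L ε) hJε v u) f
  rw [S6] at hq
  exact hq

end Summit.HodgeConjecture.HodgeConjecture.Cruxes.H413.F0P2oLineWeilCMLineMatching

end
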